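import Summits.QuantumFields.BalabanUV.Beta.EriceRemainderEnclosureHistoryAutonomyComparisonTowerFreeSteps
import Summits.QuantumFields.BalabanUV.Beta.EriceRemainderEnclosureHistoryAutonomyComparisonTowerFreeEndsBudget
import Summits.QuantumFields.BalabanUV.Beta.EriceRemainderEnclosureHistoryAutonomyComparisonTowerRatioFourStep

/-!
# EriceRemainderEnclosureHistoryAutonomyComparisonTowerChainFourFreeEnds — (E67d) THE WINDOW BUDGET CLOSES THE DUAL CHAIN ON TOWERS OF RATIO `≥ 4` WITH FREE
# ENDS: consecutive ratios `4·pred k ≤ k` are required only for the MIDDLE steps — the first step (from the youngest age) and the last step (to the oldest age)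
# may have ANY ratio.  The chain values: `λ_{m₀} = σ₀ = x₀∕(1 − 3x₀∕4)` exact at the youngest age, the hyperbolic `λ_k = 4Z_k∕(2 − Z_k)` of (E66b) at the middle
# ages, the minimal recursion value at the oldest; the free first step lands in the hyperbolic region by (E67a) `first_step_free` (the one-step transport
# `a·μ₀` of (E65c) is what tames ratios near `1`), the middle steps are (E66a)∕(E66b) verbatim ((E67b) `budget_line_at`), the last step needs only the chain
# CONDITION, which (E67a) `last_step_free` gives from the region.  With (E67e): every finite age set whose INNER consecutive ratios are `≥ 4` compares — in
# particular EVERY SET OF AT MOST THREE AGES, whatever the ratios and sizes ((T3) of the READMEs: three ages complete)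

Cell `pub-balaban`, β-function sub-cell, BINDER row D4 «RemainderConst leaves for Bałaban's split» (`HOME/BINDER-OWNERS.md`; owner lineage `b2b-balaban-beta-an4`;
this file by co-owner #2 lineage `b2b-balaban-beta-d4-p2`, generation 59), β-FLOW TEAM duty (1), FREEZE (0) honoured (def-free; (E66a) `step_poly4` ∕
`cond_poly4` ∕ `load_le_of_window_budget`, (E67a) `first_step_free` ∕ `last_step_free`, (E67b) `budget_line_at` ∕ `crude_line_at`, (E67c) `ratio_four_step` ∕
`sum_le_of_crude_line` BY NAME).

HONEST FRAMING (page 1, verbatim and binding).  *"Discharging BetaPertH makes Bałaban's UV stability UNCONDITIONAL — a real constructive-QFT result; it is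
NOT the continuum limit and NOT the Clay problem."*  THIS FILE DISCHARGES NOTHING OF THE KIND.  A lemma about finitely many non-negative reals; its use is
through (E65f), whose hypotheses are those of a census, not facts; nothing of Bałaban's is asserted.  Row D4 class UNCHANGED (critical-path width 0; instance
0∕1; D4 DISCHARGE NO DATE).  HONEST DEPENDENCY: continuum YM on T⁴ ⇐ BetaPertH ∧ nine spine estimates (0/9 proved); BetaPertH ⇐ (D1) ∧ (D4) ∧ CAP+tail;
G-an2-4 gates asym, D1 and NE2/3/4.

THE POINT (census sense (α); the COMPARISON column, conjecture (E58′), target (T3)).  The three-age problem was open in the region `{r₁₂r₂₃ > 36, min < 6}`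
after (E64h) and (P3·T1) (READMEs g57∕g58); a three-age set is a tower whose two steps are the first and the last, so this file covers ALL of it.  Numerics
(README `freesteps.py`): after a free first step `Z ≤ √2∕2` and `λ ≤ 4Z∕(2 − Z)` with normalized margin `0.23`; the free last condition value is `≤ 0.88`.  NOT
CLAIMED: a free step in the middle of a tower; consecutive inner ratios below `4`; anything printed.

WHAT IS PROVED ([folklore]; 0 `def`, 0 sorry).  **`dual_chain_of_tower_four_free_ends`**.
-/
noncomputable section
open Finset

namespace Summit.QuantumFields.BalabanUV.Beta.EriceRemainderEnclosureHistoryAutonomyComparisonTowerChainFourFreeEnds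

open Summit.QuantumFields.BalabanUV.Beta.EriceRemainderEnclosureHistoryAutonomyComparisonTowerChainFourLemmas (load_le_of_window_budget)
open Summit.QuantumFields.BalabanUV.Beta.EriceRemainderEnclosureHistoryAutonomyComparisonTowerFreeSteps (first_step_free last_step_free)
open Summit.QuantumFields.BalabanUV.Beta.EriceRemainderEnclosureHistoryAutonomyComparisonTowerFreeEndsBudget (budget_line_at crude_line_at)
open Summit.QuantumFields.BalabanUV.Beta.EriceRemainderEnclosureHistoryAutonomyComparisonTowerRatioFourStep (ratio_four_step sum_le_of_crude_line)

/-! ## The dual chain on a tower of ratio `≥ 4` with free ends -/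

set_option maxHeartbeats 1600000 in
/-- **THE WINDOW BUDGET CLOSES THE DUAL CHAIN ON TOWERS OF INNER RATIO `≥ 4`.**  `A` a finite set of ages `≥ 1` with minimum `m₀`, maximum `M₀` and predecessor
map `pred`; `4·pred k ≤ k` for every `k` except possibly the first step (`pred k = m₀`) and the last (`k = M₀`); loads `x ≥ 0` obeying the WINDOW BUDGET of
(E65a) at every scale `j = k ∈ A` — exactly what (E65b)∕(E65f) offer.  Then there are `μ, λ ≥ 0` on `A` satisfying every inequality of the dual chain of (E65e)
(as demanded by (E65f)).  In particular for `#A ≤ 3` there is no hypothesis on the ratios at all. [folklore] -/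
theorem dual_chain_of_tower_four_free_ends {A : Finset ℕ} {x : ℕ → ℝ} {pred : ℕ → ℕ} {m₀ M₀ : ℕ}
    (hA1 : ∀ k ∈ A, 1 ≤ k) (hx : ∀ k ∈ A, 0 ≤ x k) (hm₀ : m₀ ∈ A) (hmin : ∀ k ∈ A, m₀ ≤ k) (hmax : ∀ k ∈ A, k ≤ M₀)
    (hpred : ∀ k ∈ A, k ≠ m₀ → pred k ∈ A ∧ pred k < k ∧ ∀ k'' ∈ A, k'' < k → k'' ≤ pred k)
    (hfree : ∀ k ∈ A, k ≠ m₀ → pred k ≠ m₀ → k ≠ M₀ → 4 * pred k ≤ k)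
    (hbud : ∀ k ∈ A, ∑ s ∈ A, x s * (if s ≤ k then (∑ l ∈ range k, Real.sqrt ((s : ℝ) / ((s : ℝ) + l + 1))) / k
        else (∑ l ∈ range k, Real.sqrt ((s : ℝ) / ((s : ℝ) + l + 1))) / s) ≤ 1 / 2) :
    ∃ μ lam : ℕ → ℝ, (∀ k ∈ A, 0 ≤ μ k) ∧ (∀ k ∈ A, 0 ≤ lam k) ∧
      3 / 4 * x m₀ ≤ μ m₀ * (1 - 3 / 4 * x m₀) ∧ x m₀ ≤ lam m₀ * (1 - 3 / 4 * x m₀) ∧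
      (∀ k ∈ A, k ≠ m₀ →
        x k * (min (4 * (pred k : ℝ) * k / ((k : ℝ) + pred k) ^ 2 * μ (pred k)) (2 * lam (pred k) * ((pred k : ℝ) / k)) + 3 / 4) < 1) ∧
      (∀ k ∈ A, k ≠ m₀ →
        min (4 * (pred k : ℝ) * k / ((k : ℝ) + pred k) ^ 2 * μ (pred k)) (2 * lam (pred k) * ((pred k : ℝ) / k)) * (1 + x k) + 3 / 4 * x k ≤
          μ k * (1 - x k * (3 / 4 + min (4 * (pred k : ℝ) * k / ((k : ℝ) + pred k) ^ 2 * μ (pred k)) (2 * lam (pred k) * ((pred k : ℝ) / k))))) ∧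
      (∀ k ∈ A, k ≠ m₀ →
        lam (pred k) * ((pred k : ℝ) / k) * (1 + x k / 4) +
            x k * (1 + min (4 * (pred k : ℝ) * k / ((k : ℝ) + pred k) ^ 2 * μ (pred k)) (2 * lam (pred k) * ((pred k : ℝ) / k))) ≤
          lam k * (1 - x k * (3 / 4 + min (4 * (pred k : ℝ) * k / ((k : ℝ) + pred k) ^ 2 * μ (pred k)) (2 * lam (pred k) * ((pred k : ℝ) / k))))) := by
  classical
  have hcap : ∀ k ∈ A, x k ≤ 71 / 100 := fun k hk => (load_le_of_window_budget hA1 hx hk (hbud k hk)).2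
  have hx₀ := hx m₀ hm₀
  have hc₀ := hcap m₀ hm₀
  have hden₀ : 0 < 1 - 3 / 4 * x m₀ := by linarith
  obtain ⟨Z, hZ_def⟩ : ∃ Z : ℕ → ℝ, Z = fun k => ∑ s ∈ A.filter (fun s => s ≤ k), x s * Real.sqrt ((s : ℝ) / k) := ⟨_, rfl⟩
  have hZ0 : ∀ k, 0 ≤ Z k := fun k => by
    rw [hZ_def]; exact sum_nonneg fun s hs => mul_nonneg (hx s (mem_filter.mp hs).1) (Real.sqrt_nonneg _)
  obtain ⟨F, hF_def⟩ : ∃ F : ℕ → ℝ, F = fun k => 4 * Z k / (2 - Z k) := ⟨_, rfl⟩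
  have hFk : ∀ k, F k = 4 * Z k / (2 - Z k) := fun k => by rw [hF_def]
  obtain ⟨σ₀, hσ₀_def⟩ : ∃ σ₀ : ℝ, σ₀ = x m₀ / (1 - 3 / 4 * x m₀) := ⟨_, rfl⟩
  obtain ⟨μ₀, hμ₀_def⟩ : ∃ μ₀ : ℝ, μ₀ = (3 / 4 * x m₀) / (1 - 3 / 4 * x m₀) := ⟨_, rfl⟩
  have hσ₀0 : 0 ≤ σ₀ := by rw [hσ₀_def]; exact div_nonneg hx₀ hden₀.le
  have hμ₀0 : 0 ≤ μ₀ := by rw [hμ₀_def]; exact div_nonneg (by linarith) hden₀.le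
  have hμσ : μ₀ = 3 / 4 * σ₀ := by rw [hμ₀_def, hσ₀_def]; ring
  obtain ⟨eb, heb_def⟩ : ∃ eb : ℕ → ℝ, eb = fun k => if pred k = m₀ then
      min (4 * (pred k : ℝ) * k / ((k : ℝ) + pred k) ^ 2 * μ₀) (2 * σ₀ * ((pred k : ℝ) / k)) else 2 * F (pred k) * ((pred k : ℝ) / k) := ⟨_, rfl⟩
  obtain ⟨lamp, hlamp_def⟩ : ∃ lamp : ℕ → ℝ, lamp = fun k => if pred k = m₀ then σ₀ else F (pred k) := ⟨_, rfl⟩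
  obtain ⟨lam, hlam_def⟩ : ∃ lam : ℕ → ℝ, lam = fun k => if k = m₀ then σ₀ else if k = M₀ then
      (lamp k * ((pred k : ℝ) / k) * (1 + x k / 4) + x k * (1 + eb k)) / (1 - x k * (3 / 4 + eb k)) else F k := ⟨_, rfl⟩
  obtain ⟨μ, hμ_def⟩ : ∃ μ : ℕ → ℝ, μ = fun k => if k = m₀ then μ₀
      else (eb k * (1 + x k) + 3 / 4 * x k) / (1 - x k * (3 / 4 + eb k)) := ⟨_, rfl⟩
  -- Z at the youngest age and the splitting of Z at the others
  have hZm : Z m₀ = x m₀ := by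
    have hset : A.filter (fun s => s ≤ m₀) = {m₀} := by
      ext s; simp only [mem_filter, mem_singleton]
      constructor
      · rintro ⟨hs, hsm⟩; exact le_antisymm hsm (hmin s hs)
      · rintro rfl; exact ⟨hm₀, le_rfl⟩
    have hm1 : (0 : ℝ) < m₀ := by exact_mod_cast hA1 m₀ hm₀
    rw [hZ_def]; simp only [hset, sum_singleton]
    rw [div_self hm1.ne', Real.sqrt_one, mul_one]
  have hsplit : ∀ k ∈ A, k ≠ m₀ → Z k = x k + Real.sqrt ((pred k : ℝ) / k) * Z (pred k) := by
    intro k hk hne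
    obtain ⟨hpA, hplt, hpmax⟩ := hpred k hk hne
    have hkr : (0 : ℝ) < k := by exact_mod_cast hA1 k hk
    have hpr : (0 : ℝ) < pred k := by exact_mod_cast hA1 _ hpA
    have hset2 : A.filter (fun s => s ≤ k) = insert k (A.filter (fun s => s ≤ pred k)) := by
      ext s; simp only [mem_filter, mem_insert]
      constructor
      · rintro ⟨hs, hsk⟩
        rcases lt_or_eq_of_le hsk with h | h
        · exact Or.inr ⟨hs, hpmax s hs h⟩
        · exact Or.inl h
      · rintro (rfl | ⟨hs, hsp⟩)
        · exact ⟨hk, le_rfl⟩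
        · exact ⟨hs, hsp.trans hplt.le⟩
    have hnot : k ∉ A.filter (fun s => s ≤ pred k) := by
      simp only [mem_filter, not_and, not_le]; exact fun _ => hplt
    rw [hZ_def]; simp only [hset2, sum_insert hnot]
    rw [div_self hkr.ne', Real.sqrt_one, mul_one, mul_sum]
    congr 1
    refine sum_congr rfl fun s hs => ?_
    have hs0 : (0 : ℝ) ≤ s := Nat.cast_nonneg s
    rw [show (s : ℝ) / k = (pred k : ℝ) / k * ((s : ℝ) / pred k) by field_simp, Real.sqrt_mul (by positivity)]
    ring
  -- the two budget lines, in terms of Z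
  have hline4 : ∀ k ∈ A, k ≠ m₀ → 4 * pred k ≤ k →
      x k * (200 / 259) + Real.sqrt ((pred k : ℝ) / k) * Z (pred k) * (120 / 109) ≤ 1 / 2 := by
    intro k hk hne h4
    have := budget_line_at hA1 hx hm₀ hmin hpred hbud hk hne h4
    rw [hZ_def]; exact this
  have hlinec : ∀ k ∈ A, k ≠ m₀ → x k * Real.sqrt (1 / 2) +
      Z (pred k) * Real.sqrt (((pred k : ℝ) / k) / (1 + (pred k : ℝ) / k)) ≤ 1 / 2 := by
    intro k hk hne
    have := crude_line_at hA1 hx hpred hbud hk hne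
    rw [hZ_def]; exact this
  -- Z ≤ 71/100 at every age except possibly the oldest
  have hZle : ∀ k ∈ A, k ≠ M₀ → Z k ≤ 71 / 100 := by
    intro k hk hkM
    by_cases hkm : k = m₀
    · rw [hkm, hZm]; exact hc₀
    · obtain ⟨hpA, hplt, _⟩ := hpred k hk hkm
      have hkr : (0 : ℝ) < k := by exact_mod_cast hA1 k hk
      rw [hsplit k hk hkm]
      by_cases h4 : 4 * pred k ≤ k
      · have hl := hline4 k hk hkm h4
        have hu0 : 0 ≤ Real.sqrt ((pred k : ℝ) / k) * Z (pred k) := mul_nonneg (Real.sqrt_nonneg _) (hZ0 _)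
        nlinarith [hx k hk]
      · have hpm : pred k = m₀ := by
          by_contra h; exact h4 (hfree k hk hkm h hkM)
        have hl := hlinec k hk hkm
        rw [hpm, hZm] at hl ⊢
        have hr1 : (m₀ : ℝ) / k ≤ 1 := by
          rw [div_le_one hkr]; exact_mod_cast (hpm ▸ hplt).le
        exact sum_le_of_crude_line (hx k hk) hx₀ (by positivity) hr1 hl
  have hF0 : ∀ k ∈ A, k ≠ M₀ → 0 ≤ F k := fun k hk hkM => by
    have h1 := hZle k hk hkM; have h2 := hZ0 k
    rw [hFk]; exact div_nonneg (by linarith) (by linarith)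
  have hσF : σ₀ ≤ F m₀ := by
    rw [hσ₀_def, hFk, hZm, div_le_div_iff₀ hden₀ (by linarith)]
    nlinarith
  have hpredM : ∀ k ∈ A, k ≠ m₀ → pred k ≠ M₀ := fun k hk hne h => by
    obtain ⟨_, hplt, _⟩ := hpred k hk hne
    exact absurd (hmax k hk) (by rw [← h]; exact not_le.mpr hplt)
  -- lam at a predecessor, lam below F, eb below 2 F r
  have hlam_m₀ : lam m₀ = σ₀ := by rw [hlam_def]; dsimp only; rw [if_pos rfl]
  have hlam_mid : ∀ k, k ≠ m₀ → k ≠ M₀ → lam k = F k := fun k h1 h2 => by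
    rw [hlam_def]; dsimp only; rw [if_neg h1, if_neg h2]
  have hlam_M : ∀ k, k ≠ m₀ → k = M₀ →
      lam k = (lamp k * ((pred k : ℝ) / k) * (1 + x k / 4) + x k * (1 + eb k)) / (1 - x k * (3 / 4 + eb k)) := fun k h1 h2 => by
    rw [hlam_def]; dsimp only; rw [if_neg h1, if_pos h2]
  have hlamp_first : ∀ k, pred k = m₀ → lamp k = σ₀ := fun k h => by rw [hlamp_def]; dsimp only; rw [if_pos h]
  have hlamp_mid : ∀ k, pred k ≠ m₀ → lamp k = F (pred k) := fun k h => by rw [hlamp_def]; dsimp only; rw [if_neg h]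
  have hlam_pred : ∀ k ∈ A, k ≠ m₀ → lam (pred k) = lamp k := by
    intro k hk hne
    by_cases hpm : pred k = m₀
    · rw [hlamp_first k hpm, hpm, hlam_m₀]
    · rw [hlam_mid (pred k) hpm (hpredM k hk hne), hlamp_mid k hpm]
  have hlamp_le : ∀ k ∈ A, k ≠ m₀ → lamp k ≤ F (pred k) := by
    intro k hk hne
    by_cases hpm : pred k = m₀
    · rw [hlamp_first k hpm, hpm]; exact hσF
    · rw [hlamp_mid k hpm]
  have hlamp0 : ∀ k ∈ A, k ≠ m₀ → 0 ≤ lamp k := by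
    intro k hk hne
    by_cases hpm : pred k = m₀
    · rw [hlamp_first k hpm]; exact hσ₀0
    · rw [hlamp_mid k hpm]; exact hF0 _ (hpred k hk hne).1 (hpredM k hk hne)
  have hμ_m₀ : μ m₀ = μ₀ := by rw [hμ_def]; dsimp only; rw [if_pos rfl]
  have hμk : ∀ k, k ≠ m₀ → μ k = (eb k * (1 + x k) + 3 / 4 * x k) / (1 - x k * (3 / 4 + eb k)) := fun k hk => by
    rw [hμ_def]; dsimp only; rw [if_neg hk]
  have heb_first : ∀ k, pred k = m₀ →
      eb k = min (4 * (pred k : ℝ) * k / ((k : ℝ) + pred k) ^ 2 * μ₀) (2 * σ₀ * ((pred k : ℝ) / k)) := fun k h => by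
    rw [heb_def]; dsimp only; rw [if_pos h]
  have heb_mid : ∀ k, pred k ≠ m₀ → eb k = 2 * F (pred k) * ((pred k : ℝ) / k) := fun k h => by
    rw [heb_def]; dsimp only; rw [if_neg h]
  have heb_le : ∀ k ∈ A, k ≠ m₀ → eb k ≤ 2 * F (pred k) * ((pred k : ℝ) / k) := by
    intro k hk hne
    by_cases hpm : pred k = m₀
    · rw [heb_first k hpm]
      refine (min_le_right _ _).trans ?_
      have hr0 : 0 ≤ (pred k : ℝ) / k := by positivity
      rw [hpm] at hr0 ⊢
      nlinarith [mul_le_mul_of_nonneg_right hσF hr0]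
    · rw [heb_mid k hpm]
  have heb0 : ∀ k ∈ A, k ≠ m₀ → 0 ≤ eb k := by
    intro k hk hne
    by_cases hpm : pred k = m₀
    · rw [heb_first k hpm]; exact le_min (by positivity) (by positivity)
    · rw [heb_mid k hpm]; have := hF0 _ (hpred k hk hne).1 (hpredM k hk hne); positivity
  -- the criterion's defect factor is at most eb
  have he_le : ∀ k ∈ A, k ≠ m₀ →
      min (4 * (pred k : ℝ) * k / ((k : ℝ) + pred k) ^ 2 * μ (pred k)) (2 * lam (pred k) * ((pred k : ℝ) / k)) ≤ eb k := by
    intro k hk hne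
    by_cases hpm : pred k = m₀
    · rw [heb_first k hpm, hpm, hμ_m₀, hlam_m₀]
    · rw [heb_mid k hpm, hlam_mid (pred k) hpm (hpredM k hk hne)]; exact min_le_right _ _
  -- (a) the ratio-4 step: a majorant ē = 2u/(1-u) of 2 F(pred) r with the condition and the landing
  have hgen : ∀ k ∈ A, k ≠ m₀ → 4 * pred k ≤ k → ∃ e' : ℝ, 2 * F (pred k) * ((pred k : ℝ) / k) ≤ e' ∧
      x k * (e' + 3 / 4) < 1 ∧ e' / 2 * (1 + x k / 4) + x k * (1 + e') ≤ F k * (1 - x k * (3 / 4 + e')) := by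
    intro k hk hkm h4
    obtain ⟨hpA, hplt, hpmax⟩ := hpred k hk hkm
    have hkr : (0 : ℝ) < k := by exact_mod_cast hA1 k hk
    have hpr : (0 : ℝ) < pred k := by exact_mod_cast hA1 _ hpA
    have hfour' : 4 * (pred k : ℝ) ≤ k := by exact_mod_cast h4
    have hZp := hZle _ hpA (hpredM k hk hkm)
    obtain ⟨s, hs_def⟩ : ∃ s : ℝ, s = Real.sqrt ((pred k : ℝ) / k) := ⟨_, rfl⟩
    have hs0 : 0 ≤ s := by rw [hs_def]; exact Real.sqrt_nonneg _
    have hss : s * s = (pred k : ℝ) / k := by rw [hs_def]; exact Real.mul_self_sqrt (by positivity)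
    have hs2 : s ≤ 1 / 2 := by
      rw [hs_def, show (1 : ℝ) / 2 = Real.sqrt ((1 / 2) ^ 2) by rw [Real.sqrt_sq (by norm_num)]]
      apply Real.sqrt_le_sqrt
      rw [div_le_iff₀ hkr]; nlinarith
    have hl : x k * (200 / 259) + s * Z (pred k) * (120 / 109) ≤ 1 / 2 := by rw [hs_def]; exact hline4 k hk hkm h4
    obtain ⟨e', h1, h2, h3⟩ := ratio_four_step (hx k hk) (hcap k hk) (hZ0 (pred k)) hZp hs0 hs2 hl
    have hdenZ : (2 : ℝ) - Z (pred k) ≠ 0 := by have := hZp; intro h; linarith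
    have hFp : 2 * F (pred k) * ((pred k : ℝ) / k) = 8 * Z (pred k) * (s * s) / (2 - Z (pred k)) := by
      rw [hFk, hss]; field_simp; ring
    have hFK : F k = 4 * (x k + s * Z (pred k)) / (2 - (x k + s * Z (pred k))) := by rw [hFk, hsplit k hk hkm, ← hs_def]
    exact ⟨e', by rw [hFp]; exact h1, h2, by rw [hFK]; exact h3⟩
  -- (b) the free first step
  have hfirst : ∀ k ∈ A, k ≠ m₀ → pred k = m₀ → ¬ 4 * pred k ≤ k →
      eb k ≤ 3 * ((pred k : ℝ) / k) / (1 + (pred k : ℝ) / k) ^ 2 * σ₀ ∧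
      x k * (3 * ((pred k : ℝ) / k) / (1 + (pred k : ℝ) / k) ^ 2 * σ₀ + 3 / 4) < 1 ∧
      σ₀ * ((pred k : ℝ) / k) * (1 + x k / 4) + x k * (1 + 3 * ((pred k : ℝ) / k) / (1 + (pred k : ℝ) / k) ^ 2 * σ₀) ≤
        F k * (1 - x k * (3 / 4 + 3 * ((pred k : ℝ) / k) / (1 + (pred k : ℝ) / k) ^ 2 * σ₀)) := by
    intro k hk hkm hpm h4
    obtain ⟨hpA, hplt, hpmax⟩ := hpred k hk hkm
    have hkr : (0 : ℝ) < k := by exact_mod_cast hA1 k hk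
    have hpr : (0 : ℝ) < pred k := by exact_mod_cast hA1 _ hpA
    have hxk := hx k hk
    have hr1 : (pred k : ℝ) / k ≤ 1 := by rw [div_le_one hkr]; exact_mod_cast hplt.le
    have hr4 : 1 / 4 ≤ (pred k : ℝ) / k := by
      rw [le_div_iff₀ hkr]
      have : k < 4 * pred k := not_le.mp h4
      have : (k : ℝ) < 4 * pred k := by exact_mod_cast this
      linarith
    have hZpm : Z (pred k) = x m₀ := by rw [hpm, hZm]
    have hl := hlinec k hk hkm
    rw [hZpm] at hl
    have hfs := first_step_free (r := (pred k : ℝ) / k) hxk hx₀ hc₀ hr4 hr1 hl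
    have hFK : F k = 4 * (x k + Real.sqrt ((pred k : ℝ) / k) * x m₀) / (2 - (x k + Real.sqrt ((pred k : ℝ) / k) * x m₀)) := by
      rw [hFk, hsplit k hk hkm, hZpm]
    have ha : 4 * (pred k : ℝ) * k / ((k : ℝ) + pred k) ^ 2 = 4 * ((pred k : ℝ) / k) / (1 + (pred k : ℝ) / k) ^ 2 := by
      field_simp
    refine ⟨?_, ?_, ?_⟩
    · rw [heb_first k hpm]
      refine (min_le_left _ _).trans (le_of_eq ?_)
      rw [ha, hμσ]; ring
    · rw [hσ₀_def]; exact hfs.1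
    · rw [hFK, hσ₀_def]; exact hfs.2
  -- (c) the free last step (condition only)
  have hlast : ∀ k ∈ A, k ≠ m₀ → pred k ≠ m₀ → ¬ 4 * pred k ≤ k →
      x k * (2 * F (pred k) * ((pred k : ℝ) / k) + 3 / 4) < 1 := by
    intro k hk hkm hpm h4
    obtain ⟨hpA, hplt, hpmax⟩ := hpred k hk hkm
    have hkr : (0 : ℝ) < k := by exact_mod_cast hA1 k hk
    have hxk := hx k hk
    have hr1 : (pred k : ℝ) / k ≤ 1 := by rw [div_le_one hkr]; exact_mod_cast hplt.le
    have hr4 : 1 / 4 ≤ (pred k : ℝ) / k := by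
      rw [le_div_iff₀ hkr]
      have : k < 4 * pred k := not_le.mp h4
      have : (k : ℝ) < 4 * pred k := by exact_mod_cast this
      linarith
    have hZp := hZle _ hpA (hpredM k hk hkm)
    have hl := hlinec k hk hkm
    have hls := last_step_free hxk (hZ0 (pred k)) hZp hr4 hr1 hl
    rw [hFk]
    linarith [hls]
  -- condition with eb, and landing with eb, at every non-minimal age
  have hcond : ∀ k ∈ A, k ≠ m₀ → x k * (eb k + 3 / 4) < 1 := by
    intro k hk hkm
    have hxk := hx k hk
    by_cases h4 : 4 * pred k ≤ k
    · obtain ⟨e', hle, hc, _⟩ := hgen k hk hkm h4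
      have := heb_le k hk hkm
      nlinarith [mul_le_mul_of_nonneg_left (this.trans hle) hxk]
    · by_cases hpm : pred k = m₀
      · obtain ⟨hle, hc, _⟩ := hfirst k hk hkm hpm h4
        nlinarith [mul_le_mul_of_nonneg_left hle hxk]
      · have hc := hlast k hk hkm hpm h4
        rw [heb_mid k hpm]; exact hc
  have hland : ∀ k ∈ A, k ≠ m₀ → k ≠ M₀ →
      lamp k * ((pred k : ℝ) / k) * (1 + x k / 4) + x k * (1 + eb k) ≤ F k * (1 - x k * (3 / 4 + eb k)) := by
    intro k hk hkm hkM
    have hxk := hx k hk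
    have hFk0 := hF0 k hk hkM
    have hr0 : 0 ≤ (pred k : ℝ) / k := by positivity
    by_cases h4 : 4 * pred k ≤ k
    · obtain ⟨e', hle, _, hP⟩ := hgen k hk hkm h4
      have h1 : lamp k * ((pred k : ℝ) / k) ≤ e' / 2 := by
        have := mul_le_mul_of_nonneg_right (hlamp_le k hk hkm) hr0; linarith
      have h2 : eb k ≤ e' := (heb_le k hk hkm).trans hle
      have h3 : lamp k * ((pred k : ℝ) / k) * (1 + x k / 4) ≤ e' / 2 * (1 + x k / 4) := mul_le_mul_of_nonneg_right h1 (by linarith)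
      have h4' : x k * (1 + eb k) ≤ x k * (1 + e') := mul_le_mul_of_nonneg_left (by linarith) hxk
      have h5 : F k * (1 - x k * (3 / 4 + e')) ≤ F k * (1 - x k * (3 / 4 + eb k)) :=
        mul_le_mul_of_nonneg_left (by nlinarith [mul_le_mul_of_nonneg_left h2 hxk]) hFk0
      linarith
    · have hpm : pred k = m₀ := by
        by_contra h; exact h4 (hfree k hk hkm h hkM)
      obtain ⟨hle, _, hP⟩ := hfirst k hk hkm hpm h4
      rw [hlamp_first k hpm]
      have h4' : x k * (1 + eb k) ≤ x k * (1 + 3 * ((pred k : ℝ) / k) / (1 + (pred k : ℝ) / k) ^ 2 * σ₀) :=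
        mul_le_mul_of_nonneg_left (by linarith) hxk
      have h5 : F k * (1 - x k * (3 / 4 + 3 * ((pred k : ℝ) / k) / (1 + (pred k : ℝ) / k) ^ 2 * σ₀)) ≤ F k * (1 - x k * (3 / 4 + eb k)) :=
        mul_le_mul_of_nonneg_left (by nlinarith [mul_le_mul_of_nonneg_left hle hxk]) hFk0
      linarith
  -- nonnegativity of the chain values
  have hlam0 : ∀ k ∈ A, 0 ≤ lam k := by
    intro k hk
    by_cases hkm : k = m₀
    · rw [hkm, hlam_m₀]; exact hσ₀0
    by_cases hkM : k = M₀
    · rw [hlam_M k hkm hkM]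
      have h1 := hcond k hk hkm; have h2 := heb0 k hk hkm; have h3 := hlamp0 k hk hkm; have h4 := hx k hk
      refine div_nonneg ?_ (by nlinarith)
      have : 0 ≤ lamp k * ((pred k : ℝ) / k) * (1 + x k / 4) := by positivity
      nlinarith
    · rw [hlam_mid k hkm hkM]; exact hF0 k hk hkM
  have hμ0 : ∀ k ∈ A, 0 ≤ μ k := by
    intro k hk
    by_cases hkm : k = m₀
    · rw [hkm, hμ_m₀]; exact hμ₀0
    · have h1 := heb0 k hk hkm
      have h2 := hx k hk
      have h3 := hcond k hk hkm
      have h5 : 0 ≤ eb k * (1 + x k) + 3 / 4 * x k := by positivity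
      have h7 : 0 ≤ 1 - x k * (3 / 4 + eb k) := by nlinarith
      rw [hμk k hkm]; exact div_nonneg h5 h7
  refine ⟨μ, lam, hμ0, hlam0, ?_, ?_, ?_, ?_, ?_⟩
  · -- base μ
    rw [hμ_m₀, hμ₀_def, div_mul_cancel₀ _ hden₀.ne']
  · -- base λ (equality)
    rw [hlam_m₀, hσ₀_def, div_mul_cancel₀ _ hden₀.ne']
  · -- condition, with e ≤ eb
    intro k hk hkm
    have h1 := hcond k hk hkm
    nlinarith [mul_le_mul_of_nonneg_left (he_le k hk hkm) (hx k hk)]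
  · -- μ-recursion, by the definition of μ at eb and monotonicity in e
    intro k hk hkm
    have h1 := hcond k hk hkm
    have hxk := hx k hk
    have hmin' := he_le k hk hkm
    set e := min (4 * (pred k : ℝ) * k / ((k : ℝ) + pred k) ^ 2 * μ (pred k)) (2 * lam (pred k) * ((pred k : ℝ) / k)) with he
    have heb0' := heb0 k hk hkm
    have hden : 0 < 1 - x k * (3 / 4 + eb k) := by nlinarith
    have hμk' : μ k * (1 - x k * (3 / 4 + eb k)) = eb k * (1 + x k) + 3 / 4 * x k := by
      rw [hμk k hkm, div_mul_cancel₀ _ hden.ne']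
    have hμ0' : 0 ≤ μ k := hμ0 k hk
    have h2 : e * (1 + x k) ≤ eb k * (1 + x k) := mul_le_mul_of_nonneg_right hmin' (by linarith)
    have h3 : μ k * (1 - x k * (3 / 4 + eb k)) ≤ μ k * (1 - x k * (3 / 4 + e)) :=
      mul_le_mul_of_nonneg_left (by nlinarith [mul_le_mul_of_nonneg_left hmin' hxk]) hμ0'
    linarith
  · -- λ-recursion: landing at the middle ages, definition at the oldest; monotone in e
    intro k hk hkm
    have hxk := hx k hk
    have hmin' := he_le k hk hkm
    set e := min (4 * (pred k : ℝ) * k / ((k : ℝ) + pred k) ^ 2 * μ (pred k)) (2 * lam (pred k) * ((pred k : ℝ) / k)) with he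
    have hlamk0 := hlam0 k hk
    rw [hlam_pred k hk hkm]
    have hrec : lamp k * ((pred k : ℝ) / k) * (1 + x k / 4) + x k * (1 + eb k) ≤ lam k * (1 - x k * (3 / 4 + eb k)) := by
      by_cases hkM : k = M₀
      · have h1 := hcond k hk hkm; have heb0' := heb0 k hk hkm
        have hden : 0 < 1 - x k * (3 / 4 + eb k) := by nlinarith
        rw [hlam_M k hkm hkM, div_mul_cancel₀ _ hden.ne']
      · rw [hlam_mid k hkm hkM]; exact hland k hk hkm hkM
    have h3 : x k * (1 + e) ≤ x k * (1 + eb k) := mul_le_mul_of_nonneg_left (by linarith) hxk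
    have h4 : lam k * (1 - x k * (3 / 4 + eb k)) ≤ lam k * (1 - x k * (3 / 4 + e)) :=
      mul_le_mul_of_nonneg_left (by nlinarith [mul_le_mul_of_nonneg_left hmin' hxk]) hlamk0
    linarith

end Summit.QuantumFields.BalabanUV.Beta.EriceRemainderEnclosureHistoryAutonomyComparisonTowerChainFourFreeEnds

end
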